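import Literature.MathematicalPhysics.QuantumFieldTheory.Balaban1983to89.Node00.Record13LiveSelectorChi
import Literature.MathematicalPhysics.QuantumFieldTheory.Balaban1983to89.Node00.Record13SepCoPChi

/-!
# NODE 00 — K0 σ-CLOSURE χ-EDITIONS, SECOND TRANCHE, FILE F6∪F7 (dag-lead g40 WORDS 58x HANDS-3 H3.1 ∕ WORDS 587 GO; RR-2 g26 INTENT T2; one leaf per D-0064):
# THE LIVE-SELECTOR SOCKETS OF `Record13SepLiveSelector` §1 AND `Record13SepCoPLiveSelector` §1 RE-ISSUED GENERIC IN THE β-SLOT χ — the bg-free core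
# `Provisos₁₃CoreChi` OUTRIGHT at node00-def-Y's χ live re-pin `θ.liveRepin₁₃Chi χ` (`provisos₁₃Core_liveRepin₁₃_of_localBg_chi ∕ _of_hasResiduals_chi`), the
# named-field constructor `provisos₁₃SepCoP_of_core_chi`, and `Provisos₁₃SepCoPChi` at the χ re-pin FROM THE (7)-GUARDED SEPARATED ROW AT THE Co CARRIER ALONE
# (`provisos₁₃SepCoP_liveRepin₁₃_of_bgSepCoP_chi`) — with the RE-CENTRED instances at `θ.liveRepin₁₃Ax` (`χ := chiβOfRecord₁₃Ax θ`, [Ax-3a])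

CITATION HEADER.  [III] = [Balaban1988Convergent] (CMP **119**) (2.12) p.256, (2.18) p.257, (2.28) p.259, (3.2)–(3.9) pp.265–266, (3.16) p.268, (3.20)–(3.22)
p.269, (3.24)–(3.25) p.270; [IV] = [Balaban1989LargeFieldI] (0.3)–(0.4) p.176, p.177; [6] = [Balaban1985RegularSpaces] (1.3)–(1.9) pp.76–77; [15] =
[Balaban1985Variational] (6)–(7) p.278.  Every declaration below is the VERBATIM body of the like-named declaration (minus the suffix `_chi` ∕ the token `Ax`) of
`Node00/Record13SepLiveSelector.lean` §1 (:107 `provisos₁₃Core_liveRepin₁₃_of_localBg`, :128 `_of_hasResiduals`) and `Node00/Record13SepCoPLiveSelector.lean` §1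
(:63 ∕ :67 faces, :73 `provisos₁₃SepCoP_of_core`, :92 `provisos₁₃SepCoP_liveRepin₁₃_of_bgSepCoP`) with EXACTLY the substitutions of [Ax-3b∕3c∕3d] ∕ F1 ∕ F2∪F3 ∕
node00-def-Y (a) `Node00/Record13LiveSelectorChi` (`liveRepin₁₃ ↦ liveRepin₁₃Chi … χ`, `Provisos₁₃Core ↦ Provisos₁₃CoreChi … χ`, `Provisos₁₃SepCoP ↦ Provisos₁₃SepCoPChi … χ`,
`gOfRecord₁₃ ↦ gOfRecord₁₃Chi … χ`, `PartCompat₁₃ ↦ PartCompat₁₃Chi … χ`, `settingOfRecord₁₃ ↦ settingOfRecord₁₃Chi … χ`, `suppOfRecord₁₃{P,SepCoP} ↦ suppOfRecord₁₃{P,SepCoP}Chi … χ`,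
`UbgOfRecord₁₃CoP ↦ UbgOfRecord₁₃CoPChi … χ`, the §4c rows `…_of_localBg ↦ …_of_localBg_chi` (def-Y (a) §0, dag-lead WORDS 587 dedup of record)); the one proof-side
change is the now-explicit row `zetaMeas := hζ` (a plain field of the χ editions).  dag-n07-w3 g22's σ-closure table `SIGMA-CLOSURE-K0-V23-Ax.g22.md`
(4ca252f7ab47910a), rows `Node00.Record13SepLiveSelector` (2) and `Node00.Record13SepCoPLiveSelector` (2): all four typed here, each with its `…Ax` instance OF THE
SAME ARITY (dag-n07-w3's design answer relayed by def-Y I.21678: token map `liveRepin₁₃ ↦ liveRepin₁₃Ax`, `Provisos₁₃X ↦ Provisos₁₃XAx` inside the names).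

Cell `pub-ymgap`, LADDER-YM R4 NODE 00, seat `pub-ymgap-node00-def-RR-2` g26.  `--kind definition --supports stmt-QuantumFields-27238` (K0ᴬ door supply;
count-neutral).  PURELY ADDITIVE: a NEW leaf; no source module edited (CRIT-1 g33 terms (α)).

HONEST SCOPE.  REDUCTIONS: the core rows at the χ re-pin are def-Y (a) §0's theorems of (H-U) (itself K0c's theorem `localBgMeasurable`) and K0b's residual laws;
row P11 `bg` stays DISPLAYED as a hypothesis in both socket theorems — NOTHING of [III] ∕ [IV] ∕ [6] ∕ [15] is asserted or discharged; K0ᴬ `stmt-QuantumFields-27238`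
is NOT closed (door supply only); counts unmoved (typed 28∕28 · discharged 8∕28 · K 1∕4).  One finite `𝕋⁴` family at fixed `ε` — the route closes the conditional
finite-𝕋⁴ rung `BalabanLadder.UV` only; NOT continuum ∕ ℝ⁴ ∕ OS; the Yang–Mills mass gap (Clay) is NOT proved.  No `instance`, no `notation`, no `sorry`.
-/

noncomputable section

open MeasureTheory
open scoped Matrix.Norms.L2Operator

namespace Literature.MathematicalPhysics.QuantumFieldTheory.Balaban1983to89.Node00

open T4Continuum AveragingRT T4FiniteEpsInhabited B14.Eq218Concrete B15DeterminingSets B15RopTotal FlowStep FlowStepRuns DagBinding T4DatumAssembly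

/-! ## §1. The bg-free χ-generic core at the χ live re-pin — from (H-U), and OUTRIGHT (`Record13SepLiveSelector` §1 in the χ slot) -/

section Repin13CoreChi

variable {F : T4Family} {N : ℕ} [NeZero N] {θ : Stage13Params F N} {χ : ChiSlot F N}

/-- **★ THE bg-FREE χ-GENERIC CORE AT THE χ LIVE RE-PIN OF A PARAMETER CARRYING K0b's RESIDUALS, FROM (H-U) ALONE** (`provisos₁₃Core_liveRepin₁₃_of_localBg` in the
χ slot = def-Y (a)'s `provisos₁₃_liveRepin₁₃_of_localBg_chi` minus row P11): rows `intPiece` ∕ `measω` ∕ `measChi` ∕ `rstep` (Int form, at the χ live selector — `hsel`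
is `rfl`) are def-Y (a) §0's theorems of (H-U) `LocalBgMeasurable θ.ν` and the ζ-laws of K0b's (3.16) factor; `zetaMeas` is (H-ζ) from (H-U); `zetaUnity`, `zetaAbs`,
`rzLaws`, `ztLaws`, `ztLocal` are K0b's.  A REDUCTION — nothing of Bałaban asserted.
[cite: Balaban1988Convergent, (2.18) p.257, (2.21) p.258, (3.2)–(3.9) pp.265–266, (3.16) p.268, (3.20)–(3.22) p.269, (3.24)–(3.25) p.270; Balaban1989LargeFieldI, (0.3)–(0.4) p.176 and p.177 (bookkeeping)] -/
theorem Stage13Params.provisos₁₃Core_liveRepin₁₃_of_localBg_chi (hU : LocalBgMeasurable F N θ.ν) (hres : θ.HasResidualsOfRecord F N) :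
    (θ.liveRepin₁₃Chi F N χ).Provisos₁₃CoreChi F N χ :=
  have hζ : ZetaMeasurable F N θ.ζ := by
    rw [hres.zeta_eq]; exact zetaMeasurable_zeta316OfRecord_of_localBg hU θ.τ9.M θ.A₁
  have hζ0 : ∀ p g k s Pl Ql RS U V', 0 ≤ θ.ζ p g k s Pl Ql RS U V' := by
    rw [hres.zeta_eq]; exact fun p g k s Pl Ql RS U V' => zeta316OfRecord_nonneg θ.A₁ p g k s Pl Ql RS U V'
  { zetaMeas := hζ
    intPiece := (θ.liveRepin₁₃Chi F N χ).intPiece₁₃_of_localBg_chi χ hU hζ hres.zetaAbs hζ0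
    measω := (θ.liveRepin₁₃Chi F N χ).measω₁₃_of_localBg_chi χ hU hζ
    measChi := (θ.liveRepin₁₃Chi F N χ).measChi₁₃_of_localBg_chi χ hU
    zetaUnity := hres.zetaUnity
    zetaAbs := hres.zetaAbs
    rstep := (θ.liveRepin₁₃Chi F N χ).rstep₁₃_of_localBg_liveSel_chi χ rfl hU hζ hres.zetaAbs hζ0
    rzLaws := hres.rzLaws
    ztLaws := hres.ztLaws
    ztLocal := hres.ztLocal }

/-- **★★ THE bg-FREE χ-GENERIC CORE AT THE χ LIVE RE-PIN OF A PARAMETER CARRYING K0b's RESIDUALS — OUTRIGHT** ((H-U) is seat K0c's THEOREM `localBgMeasurable`,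
`Node00/Record12MeasurabilityAbsolute`): EVERY ROW OF THE χ-GENERIC PROVISOS EXCEPT P11 holds at every such witness, at every β-slot χ.
[cite: Balaban1988Convergent, (2.12) p.256, (2.18) p.257, (3.16) p.268, (3.22) p.269; Balaban1989LargeFieldI, (0.3)–(0.4) p.176 (bookkeeping)] -/
theorem Stage13Params.provisos₁₃Core_liveRepin₁₃_of_hasResiduals_chi (hres : θ.HasResidualsOfRecord F N) : (θ.liveRepin₁₃Chi F N χ).Provisos₁₃CoreChi F N χ :=
  θ.provisos₁₃Core_liveRepin₁₃_of_localBg_chi (localBgMeasurable F N θ.ν) hres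

end Repin13CoreChi

/-! ## §2. `Provisos₁₃SepCoPChi` from the core + pins + the (7)-guarded row, and at the χ live re-pin from the row alone (`Record13SepCoPLiveSelector` §1 in the χ slot) -/

section Repin13SepCoPChi

variable (F : T4Family) (N : ℕ) [NeZero N] (θ : Stage13Params F N) (χ : ChiSlot F N)

/-- The χ-generic (7)-guarded separated support is selector-blind: at the χ re-pin it IS `θ`'s (`rfl`). [cite: Balaban1988Convergent, (2.10) p.256 (bookkeeping)] -/
theorem Stage13Params.suppOfRecord₁₃SepCoPChi_liveRepin₁₃Chi (p : B12.RunParams) (n : ℕ) :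
    suppOfRecord₁₃SepCoPChi F N (θ.liveRepin₁₃Chi F N χ) χ p n = suppOfRecord₁₃SepCoPChi F N θ χ p n := rfl

/-- The χ-generic Co carrier is selector-blind: at the χ re-pin it IS `θ`'s (`rfl`). [cite: Balaban1988Convergent, (2.12) p.256 (bookkeeping)] -/
theorem Stage13Params.UbgOfRecord₁₃CoPChi_liveRepin₁₃Chi (p : B12.RunParams) (n : ℕ) :
    UbgOfRecord₁₃CoPChi F N (θ.liveRepin₁₃Chi F N χ) χ p n = UbgOfRecord₁₃CoPChi F N θ χ p n := rfl

variable {F N θ χ}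

/-- **`Provisos₁₃SepCoPChi` = THE bg-FREE χ-GENERIC CORE + THE PINS `hM`∕`hM₁` + THE (7)-GUARDED ROW AT THE χ-GENERIC Co CARRIER** (named-field constructor; the
token is the field's type verbatim; `provisos₁₃SepCoP_of_core` in the χ slot). [cite: Balaban1988Convergent, (2.18) p.257, (2.28) p.259, p.245 (bookkeeping)] -/
theorem Stage13Params.provisos₁₃SepCoP_of_core_chi (hc : θ.Provisos₁₃CoreChi F N χ) (hM : ∃ a : ℕ, θ.τ9.M = F.L ^ a) (hM₁ : θ.ν.M₁ ∣ θ.τ9.M)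
    (hbg : ∀ (p : B12.RunParams) (n : ℕ), n ≤ p.K → Step.InInterval θ.γ n (gOfRecord₁₃Chi F N θ χ p) → PartCompat₁₃Chi F N θ χ p n →
      BgProvisoΛ F N p.K (settingOfRecord₁₃Chi F N θ χ p) (θ.Rz p.K) θ.τ9.M n (suppOfRecord₁₃SepCoPChi F N θ χ p n) (UbgOfRecord₁₃CoPChi F N θ χ p n)) :
    θ.Provisos₁₃SepCoPChi F N χ where
  intPiece := hc.intPiece
  measω := hc.measω
  measChi := hc.measChi
  zetaUnity := hc.zetaUnity
  zetaAbs := hc.zetaAbs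
  rstep := hc.rstep
  rzLaws := hc.rzLaws
  ztLaws := hc.ztLaws
  ztLocal := hc.ztLocal
  hM := hM
  hM₁ := hM₁
  bg := hbg
  zetaMeas := hc.zetaMeas

/-- **★ `Provisos₁₃SepCoPChi` AT THE χ LIVE RE-PIN OF A PARAMETER CARRYING K0b's RESIDUALS FROM THE (7)-GUARDED SEPARATED ROW AT THE χ-GENERIC Co CARRIER ALONE**
(body form; core OUTRIGHT by §1's `provisos₁₃Core_liveRepin₁₃_of_hasResiduals_chi`; adapter `fun p n hn hw hpc s W hW => hbgSepCoP p n hn hw hpc s hW.2.1 W hW.1 hW.2.2`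
through [Ax-3d]'s membership `mem_suppOfRecord₁₃SepCoP_iff_chi`; `provisos₁₃SepCoP_liveRepin₁₃_of_bgSepCoP` in the χ slot).  Row P11 DISPLAYED.  A REDUCTION.
[cite: Balaban1988Convergent, (2.12) p.256, (2.28) p.259, (3.16) p.268, (3.22) p.269; Balaban1985RegularSpaces, (1.3)–(1.9) pp.76–77; Balaban1985Variational, (6)–(7) p.278; Balaban1989LargeFieldI, (0.3)–(0.4) p.176 (bookkeeping)] -/
theorem Stage13Params.provisos₁₃SepCoP_liveRepin₁₃_of_bgSepCoP_chi (hres : θ.HasResidualsOfRecord F N) (hM : ∃ a : ℕ, θ.τ9.M = F.L ^ a) (hM₁ : θ.ν.M₁ ∣ θ.τ9.M)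
    (hbgSepCoP : ∀ (p : B12.RunParams) (n : ℕ), n ≤ p.K → Step.InInterval (θ.liveRepin₁₃Chi F N χ).γ n (gOfRecord₁₃Chi F N (θ.liveRepin₁₃Chi F N χ) χ p) → PartCompat₁₃Chi F N (θ.liveRepin₁₃Chi F N χ) χ p n →
      ∀ s : SeqOfRecord F (θ.liveRepin₁₃Chi F N χ).ν (θ.liveRepin₁₃Chi F N χ).τ9.M (gOfRecord₁₃Chi F N (θ.liveRepin₁₃Chi F N χ) χ p) p.K n, Sect2.SeqSeparated (θ.liveRepin₁₃Chi F N χ).ν.M₁ s →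
      ∀ W : MSField (F.P p.K) (SU N), W ∈ suppOfRecord₁₃PChi F N (θ.liveRepin₁₃Chi F N χ) χ p n s →
      Sect2.DataSmall7PTop (avOfRecord F N p.K) s.Ω (suppDomOfRecord F (θ.liveRepin₁₃Chi F N χ).ν p.K s.Ω) n (fun j => (θ.liveRepin₁₃Chi F N χ).s2.cR * epsOfRecord (θ.liveRepin₁₃Chi F N χ).ν (gOfRecord₁₃Chi F N (θ.liveRepin₁₃Chi F N χ) χ p) j) W →
      ∀ j, 1 ≤ j → j ≤ n → ∀ X : (Sect2.domSys (F.P p.K) (θ.liveRepin₁₃Chi F N χ).τ9.M j).Dom,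
      (Sect2.domSites (F.P p.K) (θ.liveRepin₁₃Chi F N χ).τ9.M j X ⊆ s.Λ j →
        Sect2.ofBackgroundC (settingOfRecord₁₃Chi F N (θ.liveRepin₁₃Chi F N χ) χ p).ι (UbgOfRecord₁₃CoPChi F N (θ.liveRepin₁₃Chi F N χ) χ p n s W) ∈
          Sect2.spaceI (settingOfRecord₁₃Chi F N (θ.liveRepin₁₃Chi F N χ) χ p) ((θ.liveRepin₁₃Chi F N χ).Rz p.K) (θ.liveRepin₁₃Chi F N χ).τ9.M j (Sect2.domSites (F.P p.K) (θ.liveRepin₁₃Chi F N χ).τ9.M j X)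
            ((settingOfRecord₁₃Chi F N (θ.liveRepin₁₃Chi F N χ) χ p).lf.alpha0 ((settingOfRecord₁₃Chi F N (θ.liveRepin₁₃Chi F N χ) χ p).flow.g j)) ((settingOfRecord₁₃Chi F N (θ.liveRepin₁₃Chi F N χ) χ p).lf.alpha1 ((settingOfRecord₁₃Chi F N (θ.liveRepin₁₃Chi F N χ) χ p).flow.g j))) ∧
      (Sect2.admB (F.P p.K) (θ.liveRepin₁₃Chi F N χ).ν (θ.liveRepin₁₃Chi F N χ).τ9.M (gOfRecord₁₃Chi F N (θ.liveRepin₁₃Chi F N χ) χ p) s.Ω s.Λ j (Sect2.domSites (F.P p.K) (θ.liveRepin₁₃Chi F N χ).τ9.M j X) = true →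
        Sect2.ofBackgroundC (settingOfRecord₁₃Chi F N (θ.liveRepin₁₃Chi F N χ) χ p).ι (UbgOfRecord₁₃CoPChi F N (θ.liveRepin₁₃Chi F N χ) χ p n s W) ∈
          Sect2.spaceMS (settingOfRecord₁₃Chi F N (θ.liveRepin₁₃Chi F N χ) χ p) ((θ.liveRepin₁₃Chi F N χ).Rz p.K) (θ.liveRepin₁₃Chi F N χ).τ9.M j (Sect2.domSites (F.P p.K) (θ.liveRepin₁₃Chi F N χ).τ9.M j X) s.Ω)) :
    (θ.liveRepin₁₃Chi F N χ).Provisos₁₃SepCoPChi F N χ :=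
  (θ.liveRepin₁₃Chi F N χ).provisos₁₃SepCoP_of_core_chi (θ.provisos₁₃Core_liveRepin₁₃_of_hasResiduals_chi hres) hM hM₁
    fun p n hn hw hpc s W hW => hbgSepCoP p n hn hw hpc s hW.2.1 W hW.1 hW.2.2

end Repin13SepCoPChi

/-! ## §3. The RE-CENTRED instances at `θ.liveRepin₁₃Ax` (`χ := chiβOfRecord₁₃Ax θ`; same arity as the bare names) -/

section Ax

variable {F : T4Family} {N : ℕ} [NeZero N] (θ : Stage13Params F N)

/-- `Provisos₁₃CoreAx` at the re-centred re-pin IS §1's χ core at `chiβOfRecord₁₃Ax θ` (`Iff.rfl`, through def-Y (a)'s `chiβOfRecord₁₃Ax_liveRepin₁₃Ax`).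
[cite: Balaban1988Convergent, (2.18) p.257 (bookkeeping)] -/
theorem Stage13Params.provisos₁₃CoreAx_liveRepin₁₃Ax_iff :
    (θ.liveRepin₁₃Ax F N).Provisos₁₃CoreAx F N ↔ (θ.liveRepin₁₃Chi F N (chiβOfRecord₁₃Ax F N θ)).Provisos₁₃CoreChi F N (chiβOfRecord₁₃Ax F N θ) := Iff.rfl

/-- `Provisos₁₃SepCoPAx` at the re-centred re-pin IS §2's χ proviso at `chiβOfRecord₁₃Ax θ` (`Iff.rfl`). [cite: Balaban1988Convergent, (2.18) p.257, (2.28) p.259 (bookkeeping)] -/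
theorem Stage13Params.provisos₁₃SepCoPAx_liveRepin₁₃Ax_iff :
    (θ.liveRepin₁₃Ax F N).Provisos₁₃SepCoPAx F N ↔ (θ.liveRepin₁₃Chi F N (chiβOfRecord₁₃Ax F N θ)).Provisos₁₃SepCoPChi F N (chiβOfRecord₁₃Ax F N θ) := Iff.rfl

variable {θ}

/-- **★★ THE RE-CENTRED bg-FREE CORE AT THE RE-CENTRED RE-PIN OF A PARAMETER CARRYING K0b's RESIDUALS — OUTRIGHT** (instance `χ := chiβOfRecord₁₃Ax θ` of
`provisos₁₃Core_liveRepin₁₃_of_hasResiduals_chi`). [cite: Balaban1988Convergent, (2.12) p.256, (2.18) p.257, (3.16) p.268, (3.22) p.269; Balaban1989LargeFieldI, (0.3)–(0.4) p.176 (bookkeeping)] -/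
theorem Stage13Params.provisos₁₃Core_liveRepin₁₃Ax_of_hasResiduals (hres : θ.HasResidualsOfRecord F N) : (θ.liveRepin₁₃Ax F N).Provisos₁₃CoreAx F N :=
  θ.provisos₁₃Core_liveRepin₁₃_of_hasResiduals_chi hres

/-- **★★ THE RE-CENTRED bg-FREE CORE AT THE RE-CENTRED RE-PIN from (H-U)** (instance of `provisos₁₃Core_liveRepin₁₃_of_localBg_chi`). [cite: Balaban1988Convergent, (2.18) p.257, (3.16) p.268, (3.22) p.269; Balaban1989LargeFieldI, (0.3)–(0.4) p.176 (bookkeeping)] -/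
theorem Stage13Params.provisos₁₃Core_liveRepin₁₃Ax_of_localBg (hU : LocalBgMeasurable F N θ.ν) (hres : θ.HasResidualsOfRecord F N) :
    (θ.liveRepin₁₃Ax F N).Provisos₁₃CoreAx F N :=
  θ.provisos₁₃Core_liveRepin₁₃_of_localBg_chi hU hres

/-- **`Provisos₁₃SepCoPAx` = THE RE-CENTRED CORE + PINS + THE (7)-GUARDED ROW AT THE RE-CENTRED Co CARRIER** (instance `χ := chiβOfRecord₁₃Ax θ` of
`provisos₁₃SepCoP_of_core_chi`). [cite: Balaban1988Convergent, (2.18) p.257, (2.28) p.259, p.245 (bookkeeping)] -/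
theorem Stage13Params.provisos₁₃SepCoPAx_of_core (hc : θ.Provisos₁₃CoreAx F N) (hM : ∃ a : ℕ, θ.τ9.M = F.L ^ a) (hM₁ : θ.ν.M₁ ∣ θ.τ9.M)
    (hbg : ∀ (p : B12.RunParams) (n : ℕ), n ≤ p.K → Step.InInterval θ.γ n (gOfRecord₁₃Ax F N θ p) → PartCompat₁₃Chi F N θ (chiβOfRecord₁₃Ax F N θ) p n →
      BgProvisoΛ F N p.K (settingOfRecord₁₃Chi F N θ (chiβOfRecord₁₃Ax F N θ) p) (θ.Rz p.K) θ.τ9.M n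
        (suppOfRecord₁₃SepCoPChi F N θ (chiβOfRecord₁₃Ax F N θ) p n) (UbgOfRecord₁₃CoPChi F N θ (chiβOfRecord₁₃Ax F N θ) p n)) :
    θ.Provisos₁₃SepCoPAx F N :=
  Stage13Params.provisos₁₃SepCoP_of_core_chi hc hM hM₁ hbg

end Ax

end Literature.MathematicalPhysics.QuantumFieldTheory.Balaban1983to89.Node00

end
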